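import Literature.MathematicalPhysics.QuantumFieldTheory.Dimock2011to13.GaussianSingleStep

/-!
# Dimock, *The renormalization group according to Balaban* I, §2.1 LEMMA 2 (`\label{second}`): `k` block-spin steps with
# Gaussian kernels compose into ONE — the semigroup law `T_{Q,b}[T_{Q_k,a}[ρ]] = 𝒵 · T_{QQ_k, ab/(a+b)}[ρ]` PROVED with the
# order of integration justified (Fubini), the normalisation identity (preserve), and the `k`-fold tower (kth) ⇒ (second) by
# induction with explicit weights and constants

**Citation header (reproduction of PUBLISHED work; template of the Bałaban lattice Yang–Mills cell).**
J. Dimock, *The renormalization group according to Balaban I. Small fields*, Rev. Math. Phys. **25** (2013) 1330010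
(= arXiv:1108.1335v2) [Dimock2013], §2.1 "block averaging": the one-step transformation (kth) TeX L414–424, the rescaling
(scaleddensity) L425–429, the normalisation (preserve) L430–435, *"The various averaging operators can be composed"* L439–443,
LEMMA `\label{second}` (= LEMMA 2 of the global counter `\newtheorem{lem}[thm]{Lemma}`: Theorem 1 `major` L237, then this
`\begin{lem}` L447) L447–465 with its proof *"by induction"* (queen) L471–478 → (kingmaker0)/(potpie)/(tee)/(ak)/(tea)/(fifty)
L479–536 → (queen2) L538–545 → (queen3) L546–552 (TeX source held by the cell, `inputs/files/dimock/src/1108.1335/1108.1335.tex`,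
7382e6540dded9be).  J. Dimock, *… II. Large fields*, J. Math. Phys. **54** (2013) 092301 (= arXiv:1212.5562v2)
[Dimock2013BalabanII], §2.1 LEMMA 2.1 (mabel) L488–493 (the same step with regions).  Dimock's papers are published and
refereed and are the cell's TEMPLATE, not manuscripts under audit; no quantity of the Bałaban series is touched.

**What the paper prints (verbatim).**  L414–424: *"We repeat this step a number of times. After k steps we will have a
density ρ_k(Φ_k) defined on functions Φ_k : 𝕋⁰_{𝖬+𝖭−k} → ℝ. The next step is to define a density on functions Φ_{k+1} :
𝕋¹_{𝖬+𝖭−k} → ℝ by ρ̃_{k+1}(Φ_{k+1}) = 𝒩^{−1}_{aL,𝕋¹_{𝖬+𝖭−k}} ∫ exp(−(a/2L²)‖Φ_{k+1} − QΦ_k‖²) ρ_k(Φ_k) dΦ_k = 𝒩^{−1}_{aL,𝕋¹_{𝖬+𝖭−k}}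
∫ exp(−½aL|Φ_{k+1} − QΦ_k|²) ρ_k(Φ_k) dΦ_k  (kth)"*.  L430–435: *"Then we still have the normalization ∫ρ_{k+1}(Φ_{k+1})dΦ_{k+1}
= ∫ρ_k(Φ_k)dΦ_k = ∫ρ₀(Φ₀)dΦ₀  (preserve)"*.  L439–441: *"The various averaging operators can be composed into a single
averaging operation over large cubes. Let Q_k = Q^k …"*.  LEMMA 2 (L447–465): *"ρ_k(Φ_k) can be written ρ_k(Φ_k) =
𝒩^{−1}_{a_k,𝕋⁰_{𝖬+𝖭−k}} ∫ exp(−(a_k/2)‖Φ_k − Q_kφ‖²) ρ₀(φ_{L^k}) d^{(k)}φ  (second)  where φ : 𝕋^{−k}_{𝖬+𝖭−k} → ℝ, dφ^{(k)} =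
L^{−k|𝕋^{−k}_{𝖬+𝖭−k}|/2}dφ and a_k = a(1−L^{−2})/(1−L^{−2k})"*.  Proof (L471–478): *"The proof is by induction. Assuming it is
true for k we compute ρ̃_{k+1}(Φ_{k+1}) = const ∫ exp(−½(a/L²)‖Φ_{k+1} − QΦ_k‖² − (a_k/2)‖Φ_k − Q_kφ‖²) ρ₀(φ_{L^k}) d^{(k)}φ dΦ_k
(queen)"*; (L515–518) *"Here we use the identity a_{k+1} = a_ka/(a_k + aL^{−2})  (ak)"*; (L538–545) *"Now in the integral
(queen) expand around the minimizer. We write Φ_k = Ψ_k + Z and integrate over Z. The term with no Z's is (fifty). The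
linear terms in Z vanish and the terms quadratic in Z when integrated over Z yield a constant. Thus we have ρ̃_{k+1}(Φ_{k+1})
= const ∫ exp(−(a_{k+1}/2L²)‖Φ_{k+1} − Q_{k+1}φ‖²) ρ₀(φ_{L^k}) d^{(k)}φ  (queen2)"*; (L553–554) *"But the constant must be
𝒩^{−1}_{a_{k+1},𝕋⁰_{𝖬+𝖭−k−1}} in order to preserve the identity (preserve). This completes the proof."*

**Why this module.**  This lineage's `FreeFlowSingleStep` (v1.0.1) proves the completed square (fifty) = `stringy_eq`,
`GaussianSingleStep` (v1.1) the `Z`-integration (queen) → (queen2) FOR FIXED `(Φ_{k+1}, φ)` (`integral_exp_neg_stringy`,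
constant `gaussConst` explicit) and its iterated form `integral_integral_exp_neg_stringy_mul`, `BlockAveragingComposition`
(v1.0.1) the weight recursion (ak) in closed form and `BlockAveragingMatrix`/`TorusBlockAveraging` the hypothesis `QQᵀ = I`;
recorded there as NOT reproduced: *"the k-fold inductions as statements about densities"* and *"iterated order (Tonelli not
re-proved)"*.  This module supplies exactly those two things.

**What is reproduced here (kernel-checked, zero `sorry`).**  Fine fields `φ : κ → ℝ` (any measure `ν`, any `ν`-integrable
weight `ρ`), intermediate fields `Φ_k : ι → ℝ` (Lebesgue), block fields `Φ_{k+1} : σ → ℝ`; matrices `Q_k : ι × κ`, `Q : σ × ι`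
with `QQᵀ = 1` (isometric normalisation of this lineage; discharged for the torus cubes by `TorusBlockAveraging.Qt_mul_transpose`).
* §1 `gker Q b Φ′ Φ = exp(−(b/2)‖Φ′ − QΦ‖²)` and the transform `blockT Q b ν ρ Φ′ = ∫ gker Q b Φ′ Φ · ρ Φ ν(dΦ)` (= (kth) ∕
  (second) without the normalising constant, which (preserve) fixes — see §3).
* §2 **THE INDUCTIVE STEP WITH FUBINI**: `gker_mul_gker` (the (queen) integrand is `exp(−stringy)`), `integrable_uncurry`
  (JOINT integrability of `ρ(φ)·exp(−(b/2)‖Φ_{k+1} − QΦ_k‖² − (a/2)‖Φ_k − Q_kφ‖²)` on `dΦ_k ⊗ ν(dφ)` — by `integrable_prod_iff′`: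
  the `Φ_k`-sections are the Gaussians of `GaussianSingleStep.integrable_exp_neg_stringy`, their `L¹` norms are
  `|ρ(φ)|·𝒵·exp(−(a′/2)‖Φ_{k+1} − Q_{k+1}φ‖²) ≤ 𝒵|ρ(φ)|` (`integral_norm_gker_mul_gker`), integrable against `ν`), and
  **`blockT_blockT`**: `T_{Q,b}[T_{Q_k,a}[ρ]](Φ_{k+1}) = 𝒵 · T_{QQ_k,a′}[ρ](Φ_{k+1})` with `a′ = aNext a b = ab/(a+b)`,
  `𝒵 = gaussConst Q a b = √(2π)^{|ι|}/√det(a + bQᵀQ)`, for every `ν`-integrable `ρ`, `a > 0`, `b ≥ 0` — (queen) = (queen2) as an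
  identity of densities, the swap `∫dΦ_k∫ν(dφ) = ∫ν(dφ)∫dΦ_k` being `MeasureTheory.integral_integral_swap` on the proved
  joint integrability.
* §3 **(preserve)**: `integral_gker` (`𝒩_b := ∫dΦ′ exp(−(b/2)‖Φ′ − QΦ‖²) = √(2π/b)^{|σ|}` for every `Φ`, every `Q`) and
  **`integral_blockT`**: `∫dΦ′ T_{Q,b}[ρ](Φ′) = 𝒩_b · ∫ρ dν` (Fubini again: `integrable_uncurry_gker`) — so `𝒩_b^{−1}T_{Q,b}`
  preserves the total integral, *"∫ρ_{k+1} = ∫ρ_k"*.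
* §4 **THE k-FOLD TOWER = LEMMA 2**: for a sequence of lattices `𝓘 0, 𝓘 1, …` (finite types), one-step matrices
  `Qs k : 𝓘 (k+1) × 𝓘 k` with `Qs k (Qs k)ᵀ = 1` and weights `b k > 0`: `Qacc Qs k = Qs (k−1) ⋯ Qs 0` (*"Q_k = Q^k"*;
  `Qacc_mul_transpose`: it again satisfies `QQᵀ = 1`), `rhoIter Qs b ρ k` = the k-fold iterate of (kth) (unnormalised), the
  weights `accW b k` (`accW b 0 = b 0`, `accW b (k+1) = aNext (accW b k) (b (k+1))` — the recursion (ak) in the units of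
  (queen2)) and constants `accC Qs b k` (products of the `gaussConst`s), and **`rhoIter_succ`**: `ρ_{k+1}(Φ) = accC k ·
  ∫ exp(−(accW k/2)‖Φ − Qacc (k+1) φ‖²) ρ(φ) dφ` for every Lebesgue-integrable `ρ` and every `k` — (second) with explicit
  constant, proved *"by induction"* from `blockT_blockT`; `integral_rhoIter_succ`: `∫ρ_{k+1} = (Π_{j≤k} 𝒩_{b j}) ∫ρ` ((preserve)
  iterated, unnormalised form).

**Readings / divergences (declared).**  (i) UNNORMALISED TRANSFORMS WITH EXPLICIT CONSTANTS: the print normalises each step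
by `𝒩^{−1}_{aL,·}` and determines the constant of (second) a posteriori (*"the constant must be 𝒩^{−1}_{a_{k+1},·} in order to
preserve (preserve)"*); here every constant is explicit (`gaussConst`, `√(2π/b)^{|σ|}`, `accC`) and (preserve) is a theorem
about them — equivalent bookkeeping.  (ii) NO RESCALING: the print returns to the unit lattice after every step
((scaleddensity), (queen2) → (queen3)), which multiplies the weight by `L²`: `a_{k+1} = L²·aNext(a_k, a/L²)` = (ak); the tower
here stays in the units of (queen2) (`accW (k+1) = aNext (accW k) (b (k+1))`), the rescaled closed form `a_k = a(1−L^{−2})/(1−L^{−2k})`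
being kernel in `BlockAveragingComposition.aK_succ`/`aNext_aK` (`aNext (aK a L k) (a/L²) = aK a L (k+1)/L²`); rescaling is a
relabelling of the integration variables and is not modelled (as in every module of this lineage).  (iii) `ρ₀(φ_{L^k})d^{(k)}φ`
is any `ν`-integrable weight `ρ` against any s-finite measure `ν` (§2–§3) ∕ a Lebesgue-integrable `ρ` (§4); the print's `ρ₀`
is the Gaussian (def2) or the interacting density (def1), both integrable.  (iv) Isometric normalisation `QQᵀ = 1` with
unweighted dot products, as declared in `FreeFlowSingleStep`/`BlockAveragingMatrix`.

**What is NOT claimed.**  The rescaling maps and the identification of `accW` with the printed `a_k` beyond reading (ii);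
LEMMA 2.1 of part II with regions (the algebra is `LocalizedSingleStep`/`MultiRegionFreeFlow`; the Fubini step there is the
same and is not restated); §2.2's evaluation of (second) for the Gaussian `ρ₀` ((third) → (only), kernel in
`GaussianSingleStep.integral_exp_neg_action` for fixed `Φ_k`); anything of B1–B16 (Bałaban's renormalization transformations
with δ-function kernels and axial gauge, [B5] (1.12), are the cell's `Balaban1983to89/*` modules, untouched).  NOT summit
progress; NOT a statement about any Bałaban paper; NOT continuum; NOT Clay.  Unit `b2b-balaban-template` gen 31 (journal
CLAIM D1-LEMMA-SECOND-TOWER-KERNEL).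

**Version.**  v1.0.1 — DOCSTRING-ONLY fold (every declaration and proof byte-identical to v1 p203734, 2026-08-20,
commit d8b0c0fc0c04) of the cross-read XREAD VERDICT journal l.3742 (beta-lit1-g28 on request l.3673: ok CONSISTENT 5∕5,
DOCFIX 2 LOW locators, INFO 3): D1 — the (ak) sentence *"Here we use the identity …"* is TeX L515–518 (v1 said L531–536,
which is (fifty)); D2 — *"But the constant must be … This completes the proof."* is L553–554 (v1: L551–552); optional
spans adopted: (kth) L414–424 (v1: L406–420 ∕ L412–420), (scaleddensity) L425–429 (v1: L421–428), (preserve) L430–435.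
I1–I3 noted, no action.  Unit `b2b-balaban-template` gen 31.
-/

noncomputable section

open MeasureTheory Matrix Real
open scoped Matrix
open Literature.MathematicalPhysics.QuantumFieldTheory.Dimock2011to13.FreeFlowSingleStep
open Literature.MathematicalPhysics.QuantumFieldTheory.Dimock2011to13.GaussianSingleStep
open Literature.MathematicalPhysics.QuantumFieldTheory.Balaban1983to89.Beta.GaussianIntegral

namespace Literature.MathematicalPhysics.QuantumFieldTheory.Dimock2011to13.BlockTransformComposition

variable {κ ι σ : Type*} [Fintype κ] [Fintype ι] [Fintype σ]

/-! ## §1 The Gaussian block-spin kernel and transform -/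

/-- the Gaussian block-spin kernel `exp(−(b/2)‖Φ′ − QΦ‖²)` of one renormalization step ((kth): `b = aL = a/L²`;
(second): `b = a_k`, `Q = Q_k`). [cite: Dimock2013, §2.1 (kth) L414–424 and Lemma second (second) L447–455
(arXiv:1108.1335v2 TeX)] -/
def gker (Q : Matrix σ ι ℝ) (b : ℝ) (Φ' : σ → ℝ) (Φ : ι → ℝ) : ℝ :=
  Real.exp (-(b / 2) * ((Φ' - Q *ᵥ Φ) ⬝ᵥ (Φ' - Q *ᵥ Φ)))

/-- the (unnormalised) block-spin transformation with Gaussian kernel of a weight `ρ` against a measure `ν` on the fine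
fields: `T_{Q,b}[ρ](Φ′) = ∫ exp(−(b/2)‖Φ′ − QΦ‖²) ρ(Φ) ν(dΦ)` — (kth) with `ν` = Lebesgue, (second) with `ρ(φ)ν(dφ) =
ρ₀(φ_{L^k})d^{(k)}φ`. [cite: Dimock2013, §2.1 (kth) L414–424 and (second) L447–455 (arXiv:1108.1335v2 TeX)] -/
def blockT (Q : Matrix σ ι ℝ) (b : ℝ) (ν : Measure (ι → ℝ)) (ρ : (ι → ℝ) → ℝ) (Φ' : σ → ℝ) : ℝ :=
  ∫ Φ, gker Q b Φ' Φ * ρ Φ ∂ν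

/-- the kernel is positive. [folklore] -/
private theorem gker_pos (Q : Matrix σ ι ℝ) (b : ℝ) (Φ' : σ → ℝ) (Φ : ι → ℝ) : 0 < gker Q b Φ' Φ :=
  Real.exp_pos _

/-- the kernel is at most `1` for `b ≥ 0`. [folklore] -/
private theorem gker_le_one (Q : Matrix σ ι ℝ) {b : ℝ} (hb : 0 ≤ b) (Φ' : σ → ℝ) (Φ : ι → ℝ) : gker Q b Φ' Φ ≤ 1 := by
  unfold gker
  rw [Real.exp_le_one_iff]
  have h : 0 ≤ (Φ' - Q *ᵥ Φ) ⬝ᵥ (Φ' - Q *ᵥ Φ) := dotProduct_self_star_nonneg _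
  nlinarith

/-- joint continuity of `‖u − Qv‖²`. [folklore] -/
private theorem continuous_sqd (Q : Matrix σ ι ℝ) :
    Continuous fun p : (σ → ℝ) × (ι → ℝ) => (p.1 - Q *ᵥ p.2) ⬝ᵥ (p.1 - Q *ᵥ p.2) := by
  have h : Continuous fun p : (σ → ℝ) × (ι → ℝ) => p.1 - Q *ᵥ p.2 :=
    continuous_fst.sub (continuous_const.matrix_mulVec continuous_snd)
  exact h.dotProduct h

/-- joint continuity of the kernel. [folklore] -/
private theorem continuous_gker (Q : Matrix σ ι ℝ) (b : ℝ) :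
    Continuous fun p : (σ → ℝ) × (ι → ℝ) => gker Q b p.1 p.2 :=
  (continuous_const.mul (continuous_sqd Q)).rexp

/-- continuity of the kernel in the fine field. [folklore] -/
private theorem continuous_gker_right (Q : Matrix σ ι ℝ) (b : ℝ) (Φ' : σ → ℝ) :
    Continuous fun Φ : ι → ℝ => gker Q b Φ' Φ :=
  (continuous_gker Q b).comp (Continuous.prodMk_right Φ')

/-- linearity of the transform in the weight: a constant factor comes out. [cite: Dimock2013, §2.1 Lemma second proof
(queen) L471–478 *"= const ∫ …"* (arXiv:1108.1335v2 TeX)] -/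
theorem blockT_const_mul (Q : Matrix σ ι ℝ) (b : ℝ) (ν : Measure (ι → ℝ)) (c : ℝ) (ρ : (ι → ℝ) → ℝ) (Φ' : σ → ℝ) :
    blockT Q b ν (fun Φ => c * ρ Φ) Φ' = c * blockT Q b ν ρ Φ' := by
  unfold blockT
  rw [← integral_const_mul]
  refine integral_congr_ae (Filter.Eventually.of_forall fun Φ => ?_)
  simp only
  ring

/-! ## §2 Two kernels in a row: the exponent is (stringy), the integral is (queen) → (queen2), the order is Fubini -/

section Compose

variable {Qk : Matrix ι κ ℝ} {Q : Matrix σ ι ℝ} {a b : ℝ}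

/-- the product of the outer kernel (weight `b`, one step) and the inner kernel (weight `a`, `Q_k`) is `exp(−stringy)`:
`exp(−(b/2)‖Φ_{k+1} − QΦ_k‖²)·exp(−(a/2)‖Φ_k − Q_kφ‖²)` = the integrand of (queen). [cite: Dimock2013, §2.1 Lemma second proof
(queen) L471–478 (arXiv:1108.1335v2 TeX)] -/
theorem gker_mul_gker (Φ'' : σ → ℝ) (φ : κ → ℝ) (Φι : ι → ℝ) :
    gker Q b Φ'' Φι * gker Qk a Φι φ = Real.exp (-stringy Qk Q a b Φ'' φ Φι) := by
  unfold gker stringy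
  rw [← Real.exp_add]
  congr 1
  ring

variable [DecidableEq ι] [DecidableEq σ]

/-- for fixed `φ`, the (queen) integrand times `ρ(φ)` is integrable in `Φ_k`. [cite: Dimock2013, §2.1 Lemma second proof
L538–545 (arXiv:1108.1335v2 TeX)] -/
theorem integrable_gker_mul_gker (hQ : Q * Qᵀ = 1) (ha : 0 < a) (hb : 0 ≤ b) (ρ : (κ → ℝ) → ℝ) (Φ'' : σ → ℝ)
    (φ : κ → ℝ) : Integrable (fun Φι : ι → ℝ => ρ φ * (gker Q b Φ'' Φι * gker Qk a Φι φ)) := by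
  simp_rw [gker_mul_gker]
  exact (integrable_exp_neg_stringy hQ ha hb Φ'' φ).const_mul (ρ φ)

/-- the `Φ_k`-integral of the absolute integrand: `∫ dΦ_k |ρ(φ)|·exp(−stringy) = |ρ(φ)| · 𝒵 · exp(−(a′/2)‖Φ_{k+1} − QQ_kφ‖²)`.
[cite: Dimock2013, §2.1 Lemma second proof (queen2) L540–545 (arXiv:1108.1335v2 TeX)] -/
theorem integral_norm_gker_mul_gker (hQ : Q * Qᵀ = 1) (ha : 0 < a) (hb : 0 ≤ b) (ρ : (κ → ℝ) → ℝ) (Φ'' : σ → ℝ)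
    (φ : κ → ℝ) :
    ∫ Φι : ι → ℝ, ‖ρ φ * (gker Q b Φ'' Φι * gker Qk a Φι φ)‖
      = ‖ρ φ‖ * (gaussConst Q a b * gker (Q * Qk) (aNext a b) Φ'' φ) := by
  have h1 : ∀ Φι : ι → ℝ, ‖ρ φ * (gker Q b Φ'' Φι * gker Qk a Φι φ)‖
      = ‖ρ φ‖ * Real.exp (-stringy Qk Q a b Φ'' φ Φι) := by
    intro Φι
    rw [norm_mul, gker_mul_gker, Real.norm_of_nonneg (Real.exp_pos _).le]
  simp_rw [h1]
  rw [integral_const_mul, integral_exp_neg_stringy hQ ha hb Φ'' φ, gker, mulVec_mulVec]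

/-- **FUBINI FOR (queen)**: the integrand `ρ(φ)·exp(−(b/2)‖Φ_{k+1} − QΦ_k‖² − (a/2)‖Φ_k − Q_kφ‖²)` is JOINTLY integrable in
`(Φ_k, φ)` for Lebesgue measure in `Φ_k` and any s-finite `ν` in `φ` against which `ρ` is integrable — what licenses the two
integrations of (queen) in either order. [cite: Dimock2013, §2.1 Lemma second proof (queen) L471–478 (arXiv:1108.1335v2 TeX)] -/
theorem integrable_uncurry (hQ : Q * Qᵀ = 1) (ha : 0 < a) (hb : 0 ≤ b) (ν : Measure (κ → ℝ)) [SFinite ν]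
    {ρ : (κ → ℝ) → ℝ} (hρ : Integrable ρ ν) (Φ'' : σ → ℝ) :
    Integrable (Function.uncurry fun (Φι : ι → ℝ) (φ : κ → ℝ) => ρ φ * (gker Q b Φ'' Φι * gker Qk a Φι φ))
      ((volume : Measure (ι → ℝ)).prod ν) := by
  have hmeas : AEStronglyMeasurable
      (Function.uncurry fun (Φι : ι → ℝ) (φ : κ → ℝ) => ρ φ * (gker Q b Φ'' Φι * gker Qk a Φι φ))
      ((volume : Measure (ι → ℝ)).prod ν) := by
    refine (hρ.aestronglyMeasurable.comp_snd).mul (Continuous.aestronglyMeasurable ?_)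
    exact ((continuous_gker_right Q b Φ'').comp continuous_fst).mul (continuous_gker Qk a)
  rw [integrable_prod_iff' hmeas]
  refine ⟨Filter.Eventually.of_forall fun φ => integrable_gker_mul_gker hQ ha hb ρ Φ'' φ, ?_⟩
  have h2 : (fun φ : κ → ℝ => ∫ Φι : ι → ℝ, ‖ρ φ * (gker Q b Φ'' Φι * gker Qk a Φι φ)‖)
      = fun φ => (gaussConst Q a b * gker (Q * Qk) (aNext a b) Φ'' φ) * ‖ρ φ‖ := by
    funext φ
    rw [integral_norm_gker_mul_gker hQ ha hb ρ Φ'' φ, mul_comm]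
  show Integrable (fun φ : κ → ℝ => ∫ Φι : ι → ℝ, ‖ρ φ * (gker Q b Φ'' Φι * gker Qk a Φι φ)‖) ν
  rw [h2]
  refine Integrable.bdd_mul (c := gaussConst Q a b) hρ.norm ?_ ?_
  · exact (continuous_const.mul (continuous_gker_right (Q * Qk) (aNext a b) Φ'')).aestronglyMeasurable
  · refine Filter.Eventually.of_forall fun φ => ?_
    have hZ := gaussConst_pos Q ha hb
    have hab : 0 ≤ aNext a b := by unfold aNext; positivity
    rw [Real.norm_of_nonneg (mul_nonneg hZ.le (gker_pos _ _ _ _).le)]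
    exact mul_le_of_le_one_right hZ.le (gker_le_one _ hab _ _)

/-- **THE SEMIGROUP LAW OF GAUSSIAN BLOCK-SPIN TRANSFORMATIONS** = the inductive step (queen) → (queen2) of LEMMA 2 with
the order of integration JUSTIFIED: `T_{Q,b}[T_{Q_k,a}[ρ]] = 𝒵 · T_{QQ_k, ab/(a+b)}[ρ]`, i.e.
`∫ dΦ_k exp(−(b/2)‖Φ_{k+1} − QΦ_k‖²) ∫ ν(dφ) exp(−(a/2)‖Φ_k − Q_kφ‖²) ρ(φ) = 𝒵 ∫ ν(dφ) exp(−(a′/2)‖Φ_{k+1} − Q_{k+1}φ‖²) ρ(φ)`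
with `Q_{k+1} = QQ_k`, `a′ = aNext a b = ab/(a+b)`, `𝒵 = gaussConst Q a b = √(2π)^{|ι|}/√det(a + b·QᵀQ)`, for EVERY
`ν`-integrable weight `ρ`, `a > 0`, `b ≥ 0` (*"We repeat this step a number of times … The various averaging operators can
be composed into a single averaging operation"*). [cite: Dimock2013, §2.1 Lemma second L447–465 with proof (queen)–(queen2)
L471–545 (arXiv:1108.1335v2 TeX); Dimock2013BalabanII, §2.1 Lemma 2.1 (mabel) L488–493 (arXiv:1212.5562v2 TeX)] -/
theorem blockT_blockT (hQ : Q * Qᵀ = 1) (ha : 0 < a) (hb : 0 ≤ b) (ν : Measure (κ → ℝ)) [SFinite ν]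
    {ρ : (κ → ℝ) → ℝ} (hρ : Integrable ρ ν) (Φ'' : σ → ℝ) :
    blockT Q b volume (blockT Qk a ν ρ) Φ'' = gaussConst Q a b * blockT (Q * Qk) (aNext a b) ν ρ Φ'' := by
  unfold blockT
  have h1 : ∀ Φι : ι → ℝ, gker Q b Φ'' Φι * ∫ φ, gker Qk a Φι φ * ρ φ ∂ν
      = ∫ φ, ρ φ * (gker Q b Φ'' Φι * gker Qk a Φι φ) ∂ν := by
    intro Φι
    rw [← integral_const_mul]
    refine integral_congr_ae (Filter.Eventually.of_forall fun φ => ?_)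
    simp only
    ring
  simp_rw [h1]
  rw [integral_integral_swap (integrable_uncurry hQ ha hb ν hρ Φ'')]
  have h2 : ∀ φ : κ → ℝ, ∫ Φι : ι → ℝ, ρ φ * (gker Q b Φ'' Φι * gker Qk a Φι φ)
      = ρ φ * ∫ Φι : ι → ℝ, Real.exp (-stringy Qk Q a b Φ'' φ Φι) := by
    intro φ
    rw [← integral_const_mul]
    refine integral_congr_ae (Filter.Eventually.of_forall fun Φι => ?_)
    simp only [gker_mul_gker]
  simp_rw [h2]
  rw [integral_integral_exp_neg_stringy_mul hQ ha hb Φ'' ν ρ]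
  congr 1
  refine integral_congr_ae (Filter.Eventually.of_forall fun φ => ?_)
  simp only [gker, mulVec_mulVec]
  ring

end Compose

/-! ## §3 (preserve): `𝒩_b^{−1} T_{Q,b}` preserves the total integral -/

section Preserve

variable [DecidableEq σ] {Q : Matrix σ ι ℝ} {b : ℝ}

/-- `√(b^n) = (√b)^n`. [folklore] -/
private theorem sqrt_pow_eq {b : ℝ} (hb : 0 ≤ b) (n : ℕ) : Real.sqrt (b ^ n) = Real.sqrt b ^ n := by
  have h : (Real.sqrt b ^ n) ^ 2 = b ^ n := by
    rw [← pow_mul, mul_comm, pow_mul, Real.sq_sqrt hb]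
  rw [← h, Real.sqrt_sq (pow_nonneg (Real.sqrt_nonneg _) _)]

/-- the kernel as the Gaussian of the positive-definite form `b·1`, shifted by `QΦ`. [folklore] -/
private theorem gker_eq_quadForm (Q : Matrix σ ι ℝ) (b : ℝ) (Φ' : σ → ℝ) (Φ : ι → ℝ) :
    gker Q b Φ' Φ = (fun v : σ → ℝ => Real.exp (-(1/2 : ℝ) * (v ⬝ᵥ ((b : ℝ) • (1 : Matrix σ σ ℝ)) *ᵥ v)))
      (Φ' - Q *ᵥ Φ) := by
  simp only [gker, Matrix.smul_mulVec, Matrix.one_mulVec, dotProduct_smul, smul_eq_mul]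
  congr 1
  ring

omit [Fintype σ] in
/-- `b·1` is positive definite for `b > 0`. [folklore] -/
private theorem posDef_smul_one (hb : 0 < b) : ((b : ℝ) • (1 : Matrix σ σ ℝ)).PosDef := by
  rw [Matrix.smul_one_eq_diagonal]
  exact Matrix.PosDef.diagonal (fun _ => hb)

/-- **`𝒩_b := ∫ dΦ′ exp(−(b/2)‖Φ′ − QΦ‖²) = √(2π/b)^{|σ|}`** for every `Φ` and every `Q` (translation invariance of Lebesgue
measure and the Gaussian integral of `b·1`) — the normalising constant `𝒩_{aL,𝕋¹}` of (kth). [cite: Dimock2013, §2.1 (kth)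
L414–424 and (preserve) L430–435 (arXiv:1108.1335v2 TeX)] -/
theorem integral_gker (hb : 0 < b) (Φ : ι → ℝ) :
    ∫ Φ' : σ → ℝ, gker Q b Φ' Φ = Real.sqrt (2 * π / b) ^ Fintype.card σ := by
  simp_rw [gker_eq_quadForm Q b _ Φ]
  rw [integral_sub_right_eq_self (μ := (volume : Measure (σ → ℝ)))
      (fun v : σ → ℝ => Real.exp (-(1/2 : ℝ) * (v ⬝ᵥ ((b : ℝ) • (1 : Matrix σ σ ℝ)) *ᵥ v))) (Q *ᵥ Φ),
    integral_exp_neg_half_quadForm _ (posDef_smul_one hb), det_smul, det_one, mul_one,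
    sqrt_pow_eq hb.le, Real.sqrt_div (by positivity : (0:ℝ) ≤ 2 * π) b, div_pow]

/-- integrability of the kernel in the block field. [cite: Dimock2013, §2.1 (preserve) L430–435 (arXiv:1108.1335v2 TeX)] -/
theorem integrable_gker (hb : 0 < b) (Φ : ι → ℝ) : Integrable (fun Φ' : σ → ℝ => gker Q b Φ' Φ) := by
  simp_rw [gker_eq_quadForm Q b _ Φ]
  exact (integrable_exp_neg_half_quadForm _ (posDef_smul_one hb)).comp_sub_right (Q *ᵥ Φ)

/-- **FUBINI FOR (preserve)**: `gker Q b Φ′ Φ · ρ(Φ)` is jointly integrable on `dΦ′ ⊗ ν(dΦ)` for `ν`-integrable `ρ`.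
[cite: Dimock2013, §2.1 (preserve) L430–435 (arXiv:1108.1335v2 TeX)] -/
theorem integrable_uncurry_gker (hb : 0 < b) (ν : Measure (ι → ℝ)) [SFinite ν] {ρ : (ι → ℝ) → ℝ}
    (hρ : Integrable ρ ν) :
    Integrable (Function.uncurry fun (Φ' : σ → ℝ) (Φ : ι → ℝ) => gker Q b Φ' Φ * ρ Φ)
      ((volume : Measure (σ → ℝ)).prod ν) := by
  have hmeas : AEStronglyMeasurable (Function.uncurry fun (Φ' : σ → ℝ) (Φ : ι → ℝ) => gker Q b Φ' Φ * ρ Φ)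
      ((volume : Measure (σ → ℝ)).prod ν) :=
    (continuous_gker Q b).aestronglyMeasurable.mul hρ.aestronglyMeasurable.comp_snd
  rw [integrable_prod_iff' hmeas]
  refine ⟨Filter.Eventually.of_forall fun Φ => (integrable_gker hb Φ).mul_const (ρ Φ), ?_⟩
  have h2 : (fun Φ : ι → ℝ => ∫ Φ' : σ → ℝ, ‖gker Q b Φ' Φ * ρ Φ‖)
      = fun Φ => Real.sqrt (2 * π / b) ^ Fintype.card σ * ‖ρ Φ‖ := by
    funext Φ
    have h1 : ∀ Φ' : σ → ℝ, ‖gker Q b Φ' Φ * ρ Φ‖ = gker Q b Φ' Φ * ‖ρ Φ‖ := by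
      intro Φ'
      rw [norm_mul, Real.norm_of_nonneg (gker_pos _ _ _ _).le]
    simp_rw [h1]
    rw [integral_mul_const, integral_gker hb Φ]
  show Integrable (fun Φ : ι → ℝ => ∫ Φ' : σ → ℝ, ‖gker Q b Φ' Φ * ρ Φ‖) ν
  rw [h2]
  exact hρ.norm.const_mul _

/-- **(preserve)**: `∫ dΦ′ T_{Q,b}[ρ](Φ′) = 𝒩_b · ∫ ρ dν` — the normalised transformation `𝒩_b^{−1}T_{Q,b}` preserves the total
integral: *"Then we still have the normalization ∫ρ_{k+1}(Φ_{k+1})dΦ_{k+1} = ∫ρ_k(Φ_k)dΦ_k = ∫ρ₀(Φ₀)dΦ₀"*.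
[cite: Dimock2013, §2.1 (preserve) L430–435 (arXiv:1108.1335v2 TeX)] -/
theorem integral_blockT (hb : 0 < b) (ν : Measure (ι → ℝ)) [SFinite ν] {ρ : (ι → ℝ) → ℝ} (hρ : Integrable ρ ν) :
    ∫ Φ' : σ → ℝ, blockT Q b ν ρ Φ' = Real.sqrt (2 * π / b) ^ Fintype.card σ * ∫ Φ, ρ Φ ∂ν := by
  unfold blockT
  rw [integral_integral_swap (integrable_uncurry_gker hb ν hρ), ← integral_const_mul]
  refine integral_congr_ae (Filter.Eventually.of_forall fun Φ => ?_)
  simp only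
  rw [integral_mul_const, integral_gker hb Φ]

end Preserve

/-! ## §4 The `k`-fold tower: (kth) iterated ⇒ (second), by induction -/

section Tower

variable (𝓘 : ℕ → Type*) [∀ k, Fintype (𝓘 k)] [∀ k, DecidableEq (𝓘 k)]

/-- **`Q_k = Q^k`** along a tower of lattices: `Qacc Qs 0 = 1`, `Qacc Qs (k+1) = Qs k · Qacc Qs k`. [cite: Dimock2013, §2.1
L439–443 (arXiv:1108.1335v2 TeX)] -/
def Qacc (Qs : (k : ℕ) → Matrix (𝓘 (k + 1)) (𝓘 k) ℝ) : (k : ℕ) → Matrix (𝓘 k) (𝓘 0) ℝ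
  | 0 => 1
  | k + 1 => Qs k * Qacc Qs k

/-- **`ρ_k`**: the `k`-fold iterate of the (unnormalised) one-step transformation (kth) with weights `b k` applied to an
initial density `ρ` on `𝓘 0 → ℝ`. [cite: Dimock2013, §2.1 (kth) L414–424 (arXiv:1108.1335v2 TeX)] -/
def rhoIter (Qs : (k : ℕ) → Matrix (𝓘 (k + 1)) (𝓘 k) ℝ) (b : ℕ → ℝ) (ρ : (𝓘 0 → ℝ) → ℝ) :
    (k : ℕ) → (𝓘 k → ℝ) → ℝ
  | 0 => ρ
  | k + 1 => blockT (Qs k) (b k) volume (rhoIter Qs b ρ k)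

variable {𝓘}

/-- the accumulated weight after `k+1` steps: `accW b 0 = b 0`, `accW b (k+1) = aNext (accW b k) (b (k+1))` — the recursion
(ak) in the units of (queen2) (reading (ii)). [cite: Dimock2013, §2.1 Lemma second proof (ak) L515–518 (arXiv:1108.1335v2 TeX)] -/
def accW (b : ℕ → ℝ) : ℕ → ℝ
  | 0 => b 0
  | k + 1 => aNext (accW b k) (b (k + 1))

/-- the accumulated constant after `k+1` steps: the product of the one-step Gaussian constants `𝒵`. [cite: Dimock2013, §2.1
Lemma second proof (queen2) L538–545 *"yield a constant"* (arXiv:1108.1335v2 TeX)] -/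
def accC (Qs : (k : ℕ) → Matrix (𝓘 (k + 1)) (𝓘 k) ℝ) (b : ℕ → ℝ) : ℕ → ℝ
  | 0 => 1
  | k + 1 => accC Qs b k * gaussConst (Qs (k + 1)) (accW b k) (b (k + 1))

/-- positivity of the accumulated weights. [cite: Dimock2013, §2.1 Lemma second (a_k > 0) L462–464 (arXiv:1108.1335v2 TeX)] -/
theorem accW_pos {b : ℕ → ℝ} (hb : ∀ k, 0 < b k) (k : ℕ) : 0 < accW b k := by
  induction k with
  | zero => exact hb 0
  | succ k ih =>
    show 0 < aNext (accW b k) (b (k + 1))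
    unfold aNext
    have := hb (k + 1)
    positivity

/-- **the composite block map again satisfies `QQᵀ = 1`**. [cite: Dimock2013, §2.1 L439–443 with L335 (arXiv:1108.1335v2 TeX)] -/
theorem Qacc_mul_transpose {Qs : (k : ℕ) → Matrix (𝓘 (k + 1)) (𝓘 k) ℝ} (hQ : ∀ k, Qs k * (Qs k)ᵀ = 1) (k : ℕ) :
    Qacc 𝓘 Qs k * (Qacc 𝓘 Qs k)ᵀ = 1 := by
  induction k with
  | zero => simp [Qacc]
  | succ k ih =>
    show Qs k * Qacc 𝓘 Qs k * (Qs k * Qacc 𝓘 Qs k)ᵀ = 1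
    rw [Matrix.transpose_mul, Matrix.mul_assoc, ← Matrix.mul_assoc (Qacc 𝓘 Qs k), ih, Matrix.one_mul, hQ]

/-- **LEMMA 2 (second) — THE k-FOLD TOWER**: for every `k`, `ρ_{k+1}(Φ) = accC k · ∫ exp(−(accW k/2)‖Φ − Q_{k+1}φ‖²) ρ(φ) dφ`
with `Q_{k+1} = Qacc (k+1)` the composite averaging, for every Lebesgue-integrable initial density `ρ`, one-step matrices with
`QQᵀ = 1` and positive weights — *"The proof is by induction"*, each step being `blockT_blockT`. [cite: Dimock2013, §2.1 Lemma
second L447–465 with proof L471–552 (arXiv:1108.1335v2 TeX)] -/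
theorem rhoIter_succ {Qs : (k : ℕ) → Matrix (𝓘 (k + 1)) (𝓘 k) ℝ} (hQ : ∀ k, Qs k * (Qs k)ᵀ = 1) {b : ℕ → ℝ}
    (hb : ∀ k, 0 < b k) {ρ : (𝓘 0 → ℝ) → ℝ} (hρ : Integrable ρ) (k : ℕ) :
    rhoIter 𝓘 Qs b ρ (k + 1) = fun Φ => accC Qs b k * blockT (Qacc 𝓘 Qs (k + 1)) (accW b k) volume ρ Φ := by
  induction k with
  | zero =>
    funext Φ
    simp [rhoIter, Qacc, accC, accW]
  | succ k ih =>
    funext Φ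
    show blockT (Qs (k + 1)) (b (k + 1)) volume (rhoIter 𝓘 Qs b ρ (k + 1)) Φ = _
    rw [ih, blockT_const_mul,
      blockT_blockT (Qk := Qacc 𝓘 Qs (k + 1)) (hQ (k + 1)) (accW_pos hb k) (hb (k + 1)).le volume hρ Φ, ← mul_assoc]
    rfl

/-- **(preserve) along the tower, unnormalised form**: `∫ ρ_{k+1} = (Π_{j ≤ k} 𝒩_{b j}) · ∫ ρ` — dividing each step by its
`𝒩_{b j} = √(2π/b j)^{|𝓘 (j+1)|}` gives the printed *"∫ρ_{k+1}dΦ_{k+1} = ∫ρ_k dΦ_k = ∫ρ₀dΦ₀"*. [cite: Dimock2013, §2.1 (preserve)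
L429–435 (arXiv:1108.1335v2 TeX)] -/
theorem integral_rhoIter_succ {Qs : (k : ℕ) → Matrix (𝓘 (k + 1)) (𝓘 k) ℝ} (hQ : ∀ k, Qs k * (Qs k)ᵀ = 1) {b : ℕ → ℝ}
    (hb : ∀ k, 0 < b k) {ρ : (𝓘 0 → ℝ) → ℝ} (hρ : Integrable ρ) (k : ℕ) :
    ∫ Φ, rhoIter 𝓘 Qs b ρ (k + 1) Φ
      = accC Qs b k * Real.sqrt (2 * π / accW b k) ^ Fintype.card (𝓘 (k + 1)) * ∫ φ, ρ φ := by
  rw [rhoIter_succ hQ hb hρ k, integral_const_mul,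
    integral_blockT (Q := Qacc 𝓘 Qs (k + 1)) (accW_pos hb k) volume hρ, mul_assoc]

end Tower

end Literature.MathematicalPhysics.QuantumFieldTheory.Dimock2011to13.BlockTransformComposition

end
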